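import Mathlib

/-!
# LatticeQCDFlow / Scaling — importance weights, ESS and the product (volume) law

HONEST FRAMING: exact (Metropolis-corrected) sampling algorithms for lattice gauge theory;
figures of merit are autocorrelation/cost numbers at stated couplings and volumes; no
continuum-physics claim.

Venture `LatticeQCDFlow` (cell pub-lqcd), topic `Scaling`, item V1 of HOME/SCOPING.md §5 and
THEORY-2.md §4 (T2-A, T2-B); landed by FANOUT row 31 from the theory seat's checked sketch
`HOME/THEORY-2-Sketch.lean` v1.4 (decls verbatim, namespace kept).  Finite state spaces
throughout (`X` a `Fintype`; a law is a vector `X → ℝ`, the probability hypotheses are stated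
where a result needs them).  A flow model with tractable density `q` used to REWEIGHT target
expectations of `p` is importance sampling with weights `w = p / q`; its figure of merit is the
Kish effective-sample-size fraction `ESS/N = (E_q w)² / E_q[w²]`.

Results (all proved, elementary finite sums, `[folklore]` level):
* `essFrac_eq_inv` — for a normalised target `ESS/N = 1 / E_p[w] = 1 / (1 + χ²(p‖q))`;
  `essFrac_le_one`;
* `essFrac_le_exp_neg_kl` (T2-A) — `ESS/N ≤ exp(−D_KL(p‖q))` (weighted AM–GM), so any forward-KL
  lower bound that is EXTENSIVE in the number of degrees of freedom forces an exponentially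
  small ESS;
* `essFrac_prodLaw` (T2-B, two blocks) and `essFrac_blockProd` (`m` blocks),
  `essFrac_blockProd_const` — ESS is MULTIPLICATIVE over independent blocks: if target and model
  both factorise over sub-volumes, `ESS(⊗ pᵢ, ⊗ qᵢ) = ∏ ESS(pᵢ, qᵢ)`, in particular
  `ESS(m copies) = ESS(one block)^m` — the exact form, in the factorised MODEL, of the volume law
  "ESS(V) = ESS(V₀)^{V/V₀}" of Abbott et al. 2022 (arXiv:2211.07541 §V) and of the acceptance law
  of Finkenrath 2022 (arXiv:2201.02216).  It is a theorem about product laws, labelled as such;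
  the physics question is how far trained flows are from the factorised regime (THEORY-2.md §3.1,
  hypothesis (U)/(U′); `Scaling/LocalFlows.lean`).

Not here: the IMH chain and its exactness (`Exactness/`, row 30), the local-flow light cone and
the KL block-defect law (`Scaling/LocalFlows.lean`), sector budgets (`Scaling/SectorBudget.lean`),
the barrier catalogue entries (`Scaling/Barriers.lean`).
-/

namespace Summit.Ventures.LatticeQCDFlow.Theory2

open Finset

variable {X : Type*} [Fintype X]

/-! ## Importance weights, ESS, forward KL -/

/-- Importance weight `w = p/q` of the target `p` against the model `q`. [folklore] -/
noncomputable def weight (p q : X → ℝ) (x : X) : ℝ := p x / q x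

/-- Kish effective-sample-size fraction `ESS/N = (E_q w)² / E_q[w²]`
(Abbott et al. arXiv:2211.07541, eq. for ESS; Nicoli et al. PRD 108 (2023) 114501 eq. (14)).
[folklore] -/
noncomputable def essFrac (p q : X → ℝ) : ℝ :=
  (∑ x, q x * weight p q x) ^ 2 / ∑ x, q x * weight p q x ^ 2

/-- Forward (mode-covering) Kullback–Leibler divergence `D_KL(p‖q) = Σ p log(p/q)` on a finite
space with full support. [folklore] -/
noncomputable def klFin (p q : X → ℝ) : ℝ := ∑ x, p x * Real.log (p x / q x)

omit [Fintype X] in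
/-- `q · w = p` pointwise (where `q ≠ 0`). [folklore] -/
theorem mul_weight {p q : X → ℝ} {x : X} (hq : q x ≠ 0) : q x * weight p q x = p x := by
  unfold weight; field_simp

omit [Fintype X] in
/-- `q · w² = p · w` pointwise (where `q ≠ 0`). [folklore] -/
theorem mul_weight_sq {p q : X → ℝ} {x : X} (hq : q x ≠ 0) :
    q x * weight p q x ^ 2 = p x * weight p q x := by
  unfold weight; field_simp

omit [Fintype X] in
/-- `p · w = p² / q` pointwise. [folklore] -/
theorem mul_weight_eq_sq_div (p q : X → ℝ) (x : X) : p x * weight p q x = p x ^ 2 / q x := by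
  unfold weight; ring

/-- `E_q[w] = Σ p = 1` for a normalised target and a positive model. [folklore] -/
theorem sum_mul_weight {p q : X → ℝ} (hq : ∀ x, 0 < q x) (hp1 : ∑ x, p x = 1) :
    ∑ x, q x * weight p q x = 1 := by
  rw [← hp1]; exact sum_congr rfl fun x _ => mul_weight (hq x).ne'

/-- With a normalised target, `ESS/N = 1 / E_p[w] = 1 / (1 + χ²(p‖q))`. [folklore] -/
theorem essFrac_eq_inv {p q : X → ℝ} (hq : ∀ x, 0 < q x) (hp1 : ∑ x, p x = 1) :
    essFrac p q = (∑ x, p x * weight p q x)⁻¹ := by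
  rw [essFrac, sum_mul_weight hq hp1, one_pow, one_div]
  congr 1
  exact sum_congr rfl fun x _ => mul_weight_sq (hq x).ne'

/-- `ESS/N ≤ 1` for normalised `p`, `q` (Cauchy–Schwarz / Sedrakyan). [folklore] -/
theorem essFrac_le_one {p q : X → ℝ} (hq : ∀ x, 0 < q x) (hp1 : ∑ x, p x = 1)
    (hq1 : ∑ x, q x = 1) : essFrac p q ≤ 1 := by
  rw [essFrac_eq_inv hq hp1]
  simp_rw [mul_weight_eq_sq_div]
  have h := Finset.sq_sum_div_le_sum_sq_div univ p (fun x _ => hq x)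
  rw [hp1, hq1] at h
  norm_num at h
  exact inv_le_one_of_one_le₀ h

/-- **T2-A.  `ESS/N ≤ exp(−D_KL(p‖q))`.**  Weighted AM–GM (Jensen):
`exp(Σ p log w) = Π w^p ≤ Σ p·w = 1/essFrac`.  Consequence: any lower bound on the forward KL that
is EXTENSIVE in the number of degrees of freedom forces an exponentially small ESS. [folklore] -/
theorem essFrac_le_exp_neg_kl {p q : X → ℝ} (hp : ∀ x, 0 < p x) (hq : ∀ x, 0 < q x)
    (hp1 : ∑ x, p x = 1) : essFrac p q ≤ Real.exp (-klFin p q) := by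
  have hz : ∀ x, 0 < weight p q x := fun x => div_pos (hp x) (hq x)
  have hgm := Real.geom_mean_le_arith_mean_weighted univ p (weight p q)
    (fun x _ => (hp x).le) hp1 (fun x _ => (hz x).le)
  have hprod : ∏ x, weight p q x ^ p x = Real.exp (klFin p q) := by
    rw [klFin, Real.exp_sum]
    exact prod_congr rfl fun x _ => by rw [Real.rpow_def_of_pos (hz x), weight, mul_comm]
  rw [essFrac_eq_inv hq hp1, Real.exp_neg]
  rw [hprod] at hgm
  exact inv_anti₀ (Real.exp_pos _) hgm

/-! ## Independent blocks: ESS is multiplicative (volume transfer of a fixed local model) -/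

variable {Y : Type*} [Fintype Y]

/-- Product law of two independent blocks. [folklore] -/
def prodLaw (p₁ : X → ℝ) (p₂ : Y → ℝ) : X × Y → ℝ := fun z => p₁ z.1 * p₂ z.2

/-- Mass of a product law is the product of the masses. [folklore] -/
theorem sum_prodLaw (p₁ : X → ℝ) (p₂ : Y → ℝ) :
    ∑ z, prodLaw p₁ p₂ z = (∑ x, p₁ x) * ∑ y, p₂ y := by
  rw [Fintype.sum_prod_type, sum_mul_sum]; rfl

omit [Fintype X] [Fintype Y] in
/-- Importance weights of product laws factorise. [folklore] -/
theorem weight_prodLaw (p₁ q₁ : X → ℝ) (p₂ q₂ : Y → ℝ) (z : X × Y) :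
    weight (prodLaw p₁ p₂) (prodLaw q₁ q₂) z = weight p₁ q₁ z.1 * weight p₂ q₂ z.2 := by
  unfold weight prodLaw; exact mul_div_mul_comm _ _ _ _

/-- **T2-B.  ESS is multiplicative over independent blocks**: if target and model both factorise
over two blocks, `essFrac (p₁ ⊗ p₂) (q₁ ⊗ q₂) = essFrac p₁ q₁ · essFrac p₂ q₂`; iterated
(`essFrac_blockProd_const`) `ESS(k blocks) = ESS(1 block)^k`, i.e. Abbott et al. 2022 §V
"ESS(V) = ESS(V₀)^{V/V₀}" exactly, in the regime where both laws factorise over sub-volumes.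
[folklore] -/
theorem essFrac_prodLaw {p₁ q₁ : X → ℝ} {p₂ q₂ : Y → ℝ} (hq₁ : ∀ x, 0 < q₁ x)
    (hq₂ : ∀ y, 0 < q₂ y) (hp₁ : ∑ x, p₁ x = 1) (hp₂ : ∑ y, p₂ y = 1) :
    essFrac (prodLaw p₁ p₂) (prodLaw q₁ q₂) = essFrac p₁ q₁ * essFrac p₂ q₂ := by
  have hq : ∀ z, 0 < prodLaw q₁ q₂ z := fun z => mul_pos (hq₁ z.1) (hq₂ z.2)
  have hp : ∑ z, prodLaw p₁ p₂ z = 1 := by rw [sum_prodLaw, hp₁, hp₂, one_mul]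
  rw [essFrac_eq_inv hq hp, essFrac_eq_inv hq₁ hp₁, essFrac_eq_inv hq₂ hp₂, ← mul_inv]
  congr 1
  rw [Fintype.sum_prod_type, sum_mul_sum]
  exact sum_congr rfl fun x _ => sum_congr rfl fun y _ => by
    simp only [weight_prodLaw, prodLaw]; ring

/-! ## `m` independent blocks -/

variable {m : ℕ} {Z : Type*} [Fintype Z]

/-- Product law over `m` blocks (a model / target that factorises over `m` sub-volumes with
one-block laws `qb i`). [folklore] -/
noncomputable def blockProd (qb : Fin m → Z → ℝ) : (Fin m → Z) → ℝ := fun φ => ∏ i, qb i (φ i)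

/-- Mass of a block-product law. [folklore] -/
theorem sum_blockProd (qb : Fin m → Z → ℝ) : ∑ φ, blockProd qb φ = ∏ i, ∑ z, qb i z := by
  unfold blockProd
  rw [Fintype.prod_sum]

omit [Fintype Z] in
/-- A block product of positive laws is positive. [folklore] -/
theorem blockProd_pos {qb : Fin m → Z → ℝ} (hq : ∀ i z, 0 < qb i z) (φ : Fin m → Z) :
    0 < blockProd qb φ :=
  prod_pos fun i _ => hq i (φ i)

omit [Fintype Z] in
/-- Importance weights of block-product laws factorise over the blocks. [folklore] -/
theorem weight_blockProd (pb qb : Fin m → Z → ℝ) (φ : Fin m → Z) :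
    weight (blockProd pb) (blockProd qb) φ = ∏ i, weight (pb i) (qb i) (φ i) := by
  unfold weight blockProd
  rw [prod_div_distrib]

/-- **T2-B, `m` blocks.**  If target and model both factorise over `m` blocks,
`ESS(⊗ᵢ pbᵢ, ⊗ᵢ qbᵢ) = ∏ᵢ ESS(pbᵢ, qbᵢ)`. [folklore] -/
theorem essFrac_blockProd {pb qb : Fin m → Z → ℝ} (hq : ∀ i z, 0 < qb i z)
    (hp1 : ∀ i, ∑ z, pb i z = 1) :
    essFrac (blockProd pb) (blockProd qb) = ∏ i, essFrac (pb i) (qb i) := by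
  have hqφ : ∀ φ, 0 < blockProd qb φ := blockProd_pos hq
  have hpφ : ∑ φ, blockProd pb φ = 1 := by
    rw [sum_blockProd]
    exact prod_eq_one fun i _ => hp1 i
  rw [essFrac_eq_inv hqφ hpφ]
  rw [prod_congr rfl fun i (_ : i ∈ (univ : Finset (Fin m))) => essFrac_eq_inv (hq i) (hp1 i)]
  rw [prod_inv_distrib]
  congr 1
  rw [Fintype.prod_sum]
  refine sum_congr rfl fun φ _ => ?_
  rw [weight_blockProd, blockProd, ← prod_mul_distrib]

/-- **The volume law in the factorised model: `ESS(m copies of a block) = ESS(block)^m`.**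
With `V = m·V₀` this is "ESS(V) = ESS(V₀)^{V/V₀}" (Abbott et al. 2022 §V; Finkenrath 2022) as an
identity for product laws. [folklore] -/
theorem essFrac_blockProd_const {p₀ q₀ : Z → ℝ} (hq : ∀ z, 0 < q₀ z) (hp1 : ∑ z, p₀ z = 1)
    (m : ℕ) :
    essFrac (blockProd fun _ : Fin m => p₀) (blockProd fun _ : Fin m => q₀) = essFrac p₀ q₀ ^ m := by
  rw [essFrac_blockProd (fun _ => hq) (fun _ => hp1), Fin.prod_const]

end Summit.Ventures.LatticeQCDFlow.Theory2
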